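import Summits.Ventures.CertifiedManyBodySolver.Downfold.BoxesHg1201ELadderPrefix
import Summits.Ventures.CertifiedManyBodySolver.Downfold.BoxesHg1201EKinematicCoverNM19
import Summits.Ventures.CertifiedManyBodySolver.Downfold.BoxesHg1201EKinematicSlabTp
import HarnessLib

/-!
# The U-direction ladder of Hg-1201, part 16: THE CERTIFIED `U`-PREFIX ON THE M19 COLUMN (optimal doping `p = 0.16`, @0) — the twin of part 15 for the third
# route «CovHg1201M19» (captain BIRTH PACKET, hubbard-obs STATUS 2026-08-28T11:52:32Z; D1′ = ZONE (i′): w′(7/2) = 0.4950122 ≤ bar′ 0.5084577)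

Venture CertifiedManyBodySolver, cell `pub/hubbard-downfold` (MO-S1 → S2 seam; D-0154 (1)(C) COVERAGE (ii) HgBa₂CuO₄₊δ «Hg-1201»), seat `hubbard-cov-hg1201-unc-1`
(lane U MEMBERS + QUOTIENT; rulings R-ma / R-mb (b) / R-mc (a)(b) / R-me (a)); namespace `Summit.Ventures.CertifiedManyBodySolver.Downfold`. Parts 1–15 of this lane:
`BoxesHg1201ULadder` (p607319) … `BoxesHg1201ELadderPrefix` (part 15, p629949: the @0 M19b and @10 prefix doors).

THE OBJECT. The captain's packet for the M19 column (items «PatchLeftEdgeM19»: `∀ n ∈ [43/50, 22/25], σ ∈ [−27/50, −53/100], U′ ∈ [7/2, 44/5]`, torus-limit sector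
ground states at `(−27/50, U′, n)`, `−0.5084577 ≤ |D₄|⁻¹ Σ Re ω(−X₀(σ, U′))`; «PatchBottomM19»: the same at `(s, 7/2, n)`, `s ∈ [−27/50, σ]`, objective `−X₀(σ, 7/2)`) is
born on the HALVED strip `R‴ = [−27/50, −53/100] × [7/2, 44/5] × [43/50, 22/25]`, both cuts already in the tree: the `n`-cut `n_k″ = 43/50` (box-2 g1
`BoxesHg1201EKinematicCoverNM19`, `hg1201M19_cell_of_cornerStrip` / `Hg1201M19_StiffnessBoxCeiling_of_cornerStrip`, p630377) and the `t′`-cut `t* = −53/100` at stiffness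
level (unc-3 g5 `BoxesHg1201EKinematicSlabTp`, `hg1201M19_bar_kinematic_of_m53o100_le_tp`). As in part 15, the glue's curtain
`ObsStiffnessSeqCeilingAt_on_box_of_bottomEdge_and_leftEdge_targetSlot` is `U_max`-generic, so the two item words with the left edge known only on a PREFIX `[7/2, U_hi]`
give the M19 strip word on that prefix, the prefix slice ceiling on `boxHg1201E_M19` (part 14's cell-word door), and its rungs; at `U_hi = 44/5` the leaf (= the packet's
`closes`, stated here in Downfold without the route file, which is not born at this writing).

* §M1 edge words on the halved slot range ⇒ the M19 prefix strip word on `[−27/50, −13/25] × [7/2, U_hi] × [43/50, 22/25]` (curtain on `σ, tp ≤ −53/100`; the slab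
  `hg1201M19_bar_kinematic_of_m53o100_le_tp` on `tp ≥ −53/100`).
* §M2 ⇒ the prefix slice ceiling `StiffnessBoxCeilingBelow (boxHg1201E_M19.withEntry U [7/2, U_hi]) (5084577/10⁷)`; `U_hi = 44/5` ⇒ «MOS2-hg1201-M19».
* §M3 the M19 prefix rung reading and prefix `5` by name (the Jang band at every `t_eff`, straddlers on `[m/5, 3/5]`; census = part 15's `hg1201E_prefix_census`, the
  `U/t` and `t_eff` rows being shared by M19 and M19b).

Everything here is PROVED (no `sorry`, no new axiom). HONEST FRAMING: one-sided CEILINGS (CONTROL/CALIBRATION, wording class (xx1)) CONDITIONAL on edge-word hypotheses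
(the future items of «CovHg1201M19» restricted to a `U`-prefix) that do NOT exist at this writing — no M19 pinned pair has been fired; the route, its items and their
files are the PEN's / box-1's; typing certifies containment arithmetic of SCREENING-GRADE / [float] members (parts 1/5) — nothing about HgBa₂CuO₄₊δ; no row / hull / bar /
word of record is touched; no `T_c`, phase or `dT_c/dP` sentence; no summit statement is proved by this file.
-/

noncomputable section

namespace Summit.Ventures.CertifiedManyBodySolver.Downfold

open Set NonemptyInterval Filter Topology
open Summit.Ventures.CertifiedManyBodySolver.Observables
open Literature.MathematicalPhysics.QuantumLattice Literature.MathematicalPhysics.QuantumLattice.ThermodynamicLimit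
open Literature.Probability.LatticeModels
open Matrix Finset
open scoped BigOperators ComplexOrder

/-! ## §M1 The M19 prefix strip word from the two edge words on the halved slot range -/

/-- **THE M19 PREFIX STRIP WORD FROM THE TWO EDGE WORDS** (any real `U_hi ≥ 7/2`): «PatchLeftEdgeM19» restricted to `U′ ∈ [7/2, U_hi]` and «PatchBottomM19» (both on
`σ ∈ [−27/50, −53/100]`, `n ∈ [43/50, 22/25]`, value `−0.5084577`) give `ObsStiffnessSeqCeilingAt tp U n (5084577/10⁷)` on `tp ∈ [−27/50, −13/25] × U ∈ [7/2, U_hi] ×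
n ∈ [43/50, 22/25]` — the curtain with `q = −53/100`, `U_max = U_hi` below the cut, unc-3's slab above it. CONDITIONAL. [cite: KomaTasaki1994, §1] [cite: ScalapinoWhiteZhang1993, §II] -/
theorem hg1201M19_prefixStrip_of_edgeWords {Uhi : ℝ} (hUhi : 7 / 2 ≤ Uhi)
    (hL : ∀ n ∈ Set.Icc (43 / 50 : ℝ) (22 / 25), ∀ σ ∈ Set.Icc (-27 / 50 : ℝ) (-53 / 100), ∀ U' ∈ Set.Icc (7 / 2 : ℝ) Uhi,
      ∀ (ω : InfVolFermionState 2) (Ls : ℕ → ℕ) (ψ : ∀ L, Fock (Orb (FermionTorus 2 L))),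
      Tendsto Ls atTop atTop →
      (∀ j, IsGroundStateInSector (hubbardTorusTT' (Ls j) 1 (-27 / 50) U') (rectN n (Ls j)) 0 (ψ (Ls j))) →
      (∀ j, star (ψ (Ls j)) ⬝ᵥ ψ (Ls j) = 1) → ω.IsTorusLimitOf ψ Ls →
      -(5084577 / 10000000 : ℝ) ≤ ((Finset.univ : Finset (DihedralGroup 4)).card : ℝ)⁻¹ * ∑ g ∈ (Finset.univ : Finset (DihedralGroup 4)),
        (ω.expect (d4ShiftSet g 0 (Literature.Probability.LatticeModels.box 2 7))
          (fermionEmbed (PolySite.d4Emb g 0 (Literature.Probability.LatticeModels.box 2 7)) (-oddMomentObsTT σ U' 0))).re)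
    (hB : ∀ n ∈ Set.Icc (43 / 50 : ℝ) (22 / 25), ∀ σ ∈ Set.Icc (-27 / 50 : ℝ) (-53 / 100), ∀ s ∈ Set.Icc (-27 / 50 : ℝ) σ,
      ∀ (ω : InfVolFermionState 2) (Ls : ℕ → ℕ) (ψ : ∀ L, Fock (Orb (FermionTorus 2 L))),
      Tendsto Ls atTop atTop →
      (∀ j, IsGroundStateInSector (hubbardTorusTT' (Ls j) 1 s (7 / 2)) (rectN n (Ls j)) 0 (ψ (Ls j))) →
      (∀ j, star (ψ (Ls j)) ⬝ᵥ ψ (Ls j) = 1) → ω.IsTorusLimitOf ψ Ls →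
      -(5084577 / 10000000 : ℝ) ≤ ((Finset.univ : Finset (DihedralGroup 4)).card : ℝ)⁻¹ * ∑ g ∈ (Finset.univ : Finset (DihedralGroup 4)),
        (ω.expect (d4ShiftSet g 0 (Literature.Probability.LatticeModels.box 2 7))
          (fermionEmbed (PolySite.d4Emb g 0 (Literature.Probability.LatticeModels.box 2 7)) (-oddMomentObsTT σ (7 / 2) 0))).re) :
    ∀ tp ∈ Icc (-27 / 50 : ℝ) (-13 / 25), ∀ U ∈ Icc (7 / 2 : ℝ) Uhi, ∀ n ∈ Icc (43 / 50 : ℝ) (22 / 25),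
      ObsStiffnessSeqCeilingAt tp U n (5084577 / 10000000) := by
  intro tp htp U hU n hn
  rcases le_or_gt (-53 / 100 : ℝ) tp with hcut | hcut
  · exact hg1201M19_bar_kinematic_of_m53o100_le_tp ⟨hcut, by linarith [htp.2]⟩ (by linarith [hn.1]) hn.2
  · exact ObsStiffnessSeqCeilingAt_on_box_of_bottomEdge_and_leftEdge_targetSlot (p := -27 / 50) (q := -53 / 100) (UA := 7 / 2)
      (Umax := Uhi) (n := n) (by norm_num) hUhi (by norm_num) (by linarith [hn.1]) (by linarith [hn.2])
      (fun _ _ => -(5084577 / 10000000 : ℝ)) (fun _ _ => -(5084577 / 10000000 : ℝ)) (5084577 / 10000000)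
      (fun σ hσ s hs => hB n hn σ hσ s hs) (fun σ _ s _ => by norm_num) (fun σ hσ U' hU' => hL n hn σ hσ U' hU')
      (fun σ _ U' _ => by norm_num) tp ⟨htp.1, hcut.le⟩ U hU

/-! ## §M2 The M19 prefix slice ceiling; the leaf at `U_hi = 44/5` -/

/-- **THE M19 PREFIX SLICE CEILING**: the two edge words on the prefix `[7/2, U_hi]` (rational `U_hi ≥ 7/2`) give `StiffnessBoxCeilingBelow (boxHg1201E_M19.withEntry U
[7/2, U_hi]) (5084577/10⁷)` (§M1 + box-2's `hg1201M19_cell_of_cornerStrip` + part 14's `stiffnessBoxCeilingBelow_M19Ucell_of_cellWord`). CONDITIONAL.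
[cite: ScalapinoWhiteZhang1993, §II] -/
theorem stiffnessBoxCeilingBelow_M19Prefix_of_edgeWords {Uhi : ℚ} (hUhi : (7 / 2 : ℚ) ≤ Uhi)
    (hL : ∀ n ∈ Set.Icc (43 / 50 : ℝ) (22 / 25), ∀ σ ∈ Set.Icc (-27 / 50 : ℝ) (-53 / 100), ∀ U' ∈ Set.Icc (7 / 2 : ℝ) (Uhi : ℝ),
      ∀ (ω : InfVolFermionState 2) (Ls : ℕ → ℕ) (ψ : ∀ L, Fock (Orb (FermionTorus 2 L))),
      Tendsto Ls atTop atTop →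
      (∀ j, IsGroundStateInSector (hubbardTorusTT' (Ls j) 1 (-27 / 50) U') (rectN n (Ls j)) 0 (ψ (Ls j))) →
      (∀ j, star (ψ (Ls j)) ⬝ᵥ ψ (Ls j) = 1) → ω.IsTorusLimitOf ψ Ls →
      -(5084577 / 10000000 : ℝ) ≤ ((Finset.univ : Finset (DihedralGroup 4)).card : ℝ)⁻¹ * ∑ g ∈ (Finset.univ : Finset (DihedralGroup 4)),
        (ω.expect (d4ShiftSet g 0 (Literature.Probability.LatticeModels.box 2 7))
          (fermionEmbed (PolySite.d4Emb g 0 (Literature.Probability.LatticeModels.box 2 7)) (-oddMomentObsTT σ U' 0))).re)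
    (hB : ∀ n ∈ Set.Icc (43 / 50 : ℝ) (22 / 25), ∀ σ ∈ Set.Icc (-27 / 50 : ℝ) (-53 / 100), ∀ s ∈ Set.Icc (-27 / 50 : ℝ) σ,
      ∀ (ω : InfVolFermionState 2) (Ls : ℕ → ℕ) (ψ : ∀ L, Fock (Orb (FermionTorus 2 L))),
      Tendsto Ls atTop atTop →
      (∀ j, IsGroundStateInSector (hubbardTorusTT' (Ls j) 1 s (7 / 2)) (rectN n (Ls j)) 0 (ψ (Ls j))) →
      (∀ j, star (ψ (Ls j)) ⬝ᵥ ψ (Ls j) = 1) → ω.IsTorusLimitOf ψ Ls →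
      -(5084577 / 10000000 : ℝ) ≤ ((Finset.univ : Finset (DihedralGroup 4)).card : ℝ)⁻¹ * ∑ g ∈ (Finset.univ : Finset (DihedralGroup 4)),
        (ω.expect (d4ShiftSet g 0 (Literature.Probability.LatticeModels.box 2 7))
          (fermionEmbed (PolySite.d4Emb g 0 (Literature.Probability.LatticeModels.box 2 7)) (-oddMomentObsTT σ (7 / 2) 0))).re) :
    StiffnessBoxCeilingBelow (boxHg1201E_M19.withEntry .UOverT (Entry.ofEnds (7 / 2) Uhi hUhi .screening)) (5084577 / 10000000) := by
  have hU' : (7 / 2 : ℝ) ≤ (Uhi : ℝ) := by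
    have := (Rat.cast_le (K := ℝ)).mpr hUhi
    push_cast at this
    exact this
  have h := hg1201M19_cell_of_cornerStrip le_rfl (hg1201M19_prefixStrip_of_edgeWords hU' hL hB)
  refine stiffnessBoxCeilingBelow_M19Ucell_of_cellWord hUhi le_rfl fun tp htp U hU n hn => h tp htp U ⟨?_, hU.2⟩ n hn
  have h1 := hU.1
  push_cast at h1
  exact h1

/-- **AT `U_hi = 44/5`: «MOS2-hg1201-M19» FROM THE TWO ITEM WORDS OF THE PACKET** (= the packet's `closes`, stated in Downfold before the route is born: «PatchLeftEdgeM19» ∧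
«PatchBottomM19» ⇒ `Hg1201M19_StiffnessBoxCeiling`, via §M1 and box-2's `Hg1201M19_StiffnessBoxCeiling_of_cornerStrip`). CONDITIONAL. [cite: KomaTasaki1994, §1]
[cite: ScalapinoWhiteZhang1993, §II] -/
theorem Hg1201M19_StiffnessBoxCeiling_of_edgeWords
    (hL : ∀ n ∈ Set.Icc (43 / 50 : ℝ) (22 / 25), ∀ σ ∈ Set.Icc (-27 / 50 : ℝ) (-53 / 100), ∀ U' ∈ Set.Icc (7 / 2 : ℝ) (44 / 5),
      ∀ (ω : InfVolFermionState 2) (Ls : ℕ → ℕ) (ψ : ∀ L, Fock (Orb (FermionTorus 2 L))),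
      Tendsto Ls atTop atTop →
      (∀ j, IsGroundStateInSector (hubbardTorusTT' (Ls j) 1 (-27 / 50) U') (rectN n (Ls j)) 0 (ψ (Ls j))) →
      (∀ j, star (ψ (Ls j)) ⬝ᵥ ψ (Ls j) = 1) → ω.IsTorusLimitOf ψ Ls →
      -(5084577 / 10000000 : ℝ) ≤ ((Finset.univ : Finset (DihedralGroup 4)).card : ℝ)⁻¹ * ∑ g ∈ (Finset.univ : Finset (DihedralGroup 4)),
        (ω.expect (d4ShiftSet g 0 (Literature.Probability.LatticeModels.box 2 7))
          (fermionEmbed (PolySite.d4Emb g 0 (Literature.Probability.LatticeModels.box 2 7)) (-oddMomentObsTT σ U' 0))).re)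
    (hB : ∀ n ∈ Set.Icc (43 / 50 : ℝ) (22 / 25), ∀ σ ∈ Set.Icc (-27 / 50 : ℝ) (-53 / 100), ∀ s ∈ Set.Icc (-27 / 50 : ℝ) σ,
      ∀ (ω : InfVolFermionState 2) (Ls : ℕ → ℕ) (ψ : ∀ L, Fock (Orb (FermionTorus 2 L))),
      Tendsto Ls atTop atTop →
      (∀ j, IsGroundStateInSector (hubbardTorusTT' (Ls j) 1 s (7 / 2)) (rectN n (Ls j)) 0 (ψ (Ls j))) →
      (∀ j, star (ψ (Ls j)) ⬝ᵥ ψ (Ls j) = 1) → ω.IsTorusLimitOf ψ Ls →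
      -(5084577 / 10000000 : ℝ) ≤ ((Finset.univ : Finset (DihedralGroup 4)).card : ℝ)⁻¹ * ∑ g ∈ (Finset.univ : Finset (DihedralGroup 4)),
        (ω.expect (d4ShiftSet g 0 (Literature.Probability.LatticeModels.box 2 7))
          (fermionEmbed (PolySite.d4Emb g 0 (Literature.Probability.LatticeModels.box 2 7)) (-oddMomentObsTT σ (7 / 2) 0))).re) :
    Hg1201M19_StiffnessBoxCeiling :=
  Hg1201M19_StiffnessBoxCeiling_of_cornerStrip le_rfl (hg1201M19_prefixStrip_of_edgeWords (by norm_num) hL hB)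

/-! ## §M3 What a certified M19 prefix buys on the ladder -/

/-- **THE M19 PREFIX RUNG READING**: a ceiling on the M19 prefix slice `[7/2, U_hi]` certifies ONE `c ≤ bar` at every `(U eV, t_eff)` with `7t/2 ≤ U ≤ U_hi·t` over the M19
entries (`t_eff ∈ [1/2, 3/5]`, `t′ ∈ [−27/50, −43/100]`, `n ∈ [4/5, 22/25]`) and at every `U ∈ [21/10, U_hi/2]` for EVERY `t_eff`; whole member rows iff `2m ≤ U_hi` (part 15's
`hg1201E_prefix_census`: `5 →` Jang, `7 →` six, `44/5 →` 15/16). CONDITIONAL. [cite: ScalapinoWhiteZhang1993, §II] -/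
theorem hg1201E_M19prefix_rungs_of_ceiling {Uhi : ℚ} (hUhi : (7 / 2 : ℚ) ≤ Uhi) {bar : ℚ}
    (h : StiffnessBoxCeilingBelow (boxHg1201E_M19.withEntry .UOverT (Entry.ofEnds (7 / 2) Uhi hUhi .screening)) bar) :
    ∃ c : ℚ, c ≤ bar ∧
      (∀ U t tp n : ℝ, ((7 / 2 : ℝ) * t ≤ U ∧ U ≤ Uhi * t) → hg1201E_M19_t.Mem t → hg1201E_M19_tp.Mem tp → hg1201E_M19_n.Mem n →
        ObsStiffnessSeqCeilingAt tp (U / t) n c) ∧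
      (∀ U t tp n : ℝ, ((21 / 10 : ℝ) ≤ U ∧ U ≤ Uhi / 2) → hg1201E_M19_t.Mem t → hg1201E_M19_tp.Mem tp → hg1201E_M19_n.Mem n →
        ObsStiffnessSeqCeilingAt tp (U / t) n c) := by
  obtain ⟨c, hc, hW⟩ := hg1201E_M19Ucell_rungs_of_ceiling hUhi h
  refine ⟨c, hc, fun U t tp n hU ht htp hn => hW U t tp n ?_ ht htp hn, fun U t tp n hU ht htp hn => hW U t tp n ?_ ht htp hn⟩
  · have ht' := (Entry.mem_ofEnds_iff _ _ _ _ _).1 ht; push_cast at ht'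
    have ht0 : (0 : ℝ) < t := by linarith [ht'.1]
    exact ⟨by push_cast; rw [le_div_iff₀ ht0]; linarith [hU.1], by rw [div_le_iff₀ ht0]; linarith [hU.2]⟩
  · have ht' := (Entry.mem_ofEnds_iff _ _ _ _ _).1 ht; push_cast at ht'
    have hq := (hg1201E_Ucell_Ureach_iff (lo := 7 / 2) (hi := Uhi) (by norm_num) (U := U)).2 ⟨by push_cast; linarith [hU.1], hU.2⟩ t ht'
    exact ⟨by push_cast at hq ⊢; exact hq.1, hq.2⟩

/-- **M19 PREFIX `5` BY NAME** (the would-be first M19 `U`-cell, mirror of PIN-HG-U): the two edge words on `[7/2, 5]` certify ONE `c ≤ 0.5084577` at every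
`U ∈ [21/10, 5/2]` eV — the Jang band `2.15 ± 0.05` — at EVERY `t_eff`, and at each straddler `m ∈ {2.865, 2.9462, 2.98}` on `t_eff ∈ [m/5, 3/5]`, over the M19
`t′/t`, `n` entries. CONDITIONAL. [cite: ScalapinoWhiteZhang1993, §II] -/
theorem hg1201E_M19prefix5_rungs_of_edgeWords
    (hL : ∀ n ∈ Set.Icc (43 / 50 : ℝ) (22 / 25), ∀ σ ∈ Set.Icc (-27 / 50 : ℝ) (-53 / 100), ∀ U' ∈ Set.Icc (7 / 2 : ℝ) ((5 : ℚ) : ℝ),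
      ∀ (ω : InfVolFermionState 2) (Ls : ℕ → ℕ) (ψ : ∀ L, Fock (Orb (FermionTorus 2 L))),
      Tendsto Ls atTop atTop →
      (∀ j, IsGroundStateInSector (hubbardTorusTT' (Ls j) 1 (-27 / 50) U') (rectN n (Ls j)) 0 (ψ (Ls j))) →
      (∀ j, star (ψ (Ls j)) ⬝ᵥ ψ (Ls j) = 1) → ω.IsTorusLimitOf ψ Ls →
      -(5084577 / 10000000 : ℝ) ≤ ((Finset.univ : Finset (DihedralGroup 4)).card : ℝ)⁻¹ * ∑ g ∈ (Finset.univ : Finset (DihedralGroup 4)),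
        (ω.expect (d4ShiftSet g 0 (Literature.Probability.LatticeModels.box 2 7))
          (fermionEmbed (PolySite.d4Emb g 0 (Literature.Probability.LatticeModels.box 2 7)) (-oddMomentObsTT σ U' 0))).re)
    (hB : ∀ n ∈ Set.Icc (43 / 50 : ℝ) (22 / 25), ∀ σ ∈ Set.Icc (-27 / 50 : ℝ) (-53 / 100), ∀ s ∈ Set.Icc (-27 / 50 : ℝ) σ,
      ∀ (ω : InfVolFermionState 2) (Ls : ℕ → ℕ) (ψ : ∀ L, Fock (Orb (FermionTorus 2 L))),
      Tendsto Ls atTop atTop →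
      (∀ j, IsGroundStateInSector (hubbardTorusTT' (Ls j) 1 s (7 / 2)) (rectN n (Ls j)) 0 (ψ (Ls j))) →
      (∀ j, star (ψ (Ls j)) ⬝ᵥ ψ (Ls j) = 1) → ω.IsTorusLimitOf ψ Ls →
      -(5084577 / 10000000 : ℝ) ≤ ((Finset.univ : Finset (DihedralGroup 4)).card : ℝ)⁻¹ * ∑ g ∈ (Finset.univ : Finset (DihedralGroup 4)),
        (ω.expect (d4ShiftSet g 0 (Literature.Probability.LatticeModels.box 2 7))
          (fermionEmbed (PolySite.d4Emb g 0 (Literature.Probability.LatticeModels.box 2 7)) (-oddMomentObsTT σ (7 / 2) 0))).re) :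
    ∃ c : ℚ, c ≤ 5084577 / 10000000 ∧
      (∀ U t tp n : ℝ, ((21 / 10 : ℝ) ≤ U ∧ U ≤ 5 / 2) → hg1201E_M19_t.Mem t → hg1201E_M19_tp.Mem tp → hg1201E_M19_n.Mem n →
        ObsStiffnessSeqCeilingAt tp (U / t) n c) ∧
      (∀ m ∈ hg1201U_bank5_straddle, ∀ t tp n : ℝ, ((m : ℝ) / 5 ≤ t ∧ t ≤ 3 / 5) → hg1201E_M19_tp.Mem tp → hg1201E_M19_n.Mem n →
        ObsStiffnessSeqCeilingAt tp ((m : ℝ) / t) n c) := by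
  obtain ⟨c, hc, hW, hfull⟩ := hg1201E_M19prefix_rungs_of_ceiling (Uhi := 5) (by norm_num) (stiffnessBoxCeilingBelow_M19Prefix_of_edgeWords (by norm_num) hL hB)
  refine ⟨c, hc, fun U t tp n hU ht htp hn => hfull U t tp n ⟨hU.1, by push_cast; linarith [hU.2]⟩ ht htp hn, fun m hm t tp n ht htp hn => ?_⟩
  have hlo : ((573 / 200 : ℚ) : ℝ) ≤ (m : ℝ) := (Rat.cast_le (K := ℝ)).mpr (hg1201U_straddle_mem_gap hm).1.1
  have hhi : (m : ℝ) ≤ ((149 / 50 : ℚ) : ℝ) := (Rat.cast_le (K := ℝ)).mpr (hg1201U_straddle_mem_gap hm).1.2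
  push_cast at hlo hhi
  have ht1 : (1 / 2 : ℝ) ≤ t := by linarith [ht.1]
  have htE : hg1201E_M19_t.Mem t := (Entry.mem_ofEnds_iff _ _ _ _ _).2 (by push_cast; exact ⟨ht1, ht.2⟩)
  refine hW _ t tp n ⟨?_, ?_⟩ htE htp hn
  · linarith [ht.2]
  · push_cast; have := ht.1; rw [div_le_iff₀ (by norm_num : (0 : ℝ) < 5)] at this; linarith

end Summit.Ventures.CertifiedManyBodySolver.Downfold

end
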